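import Summits.QuantumFields.BalabanUV.Beta.EriceFlowEnclosureB12AsPrintedHistoryContagionShiftFlowZeroTangentSecondSmooth

/-!
# Beta / EriceFlowEnclosureB12AsPrintedHistoryContagionShiftFlowZeroTangentSecondContDiff — ASYMPTOTIC FREEDOM IS CONTAGIOUS, part 85: C² MEMORY ⟹ C² RENORMALIZATION GROUP
# — THE END OF THE SECOND VARIATION, AND ITS WITNESSES.  FOR THE FLOW (part 14's package at e′) under the C² SHAPE (`hG`, `hGB`, `hH`, `hHB`) and the continuity letter `hHc`
# of the Hessian (all explicit binders): (§155) a SECOND TANGENT FIELD exists (the second tangent flow of part 78 chosen at every pin of ]0, e′] with its ultraviolet limits);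
# (§156) the limit fields `W_∞` (part 71) and `V_∞` (part 84) are CONTINUOUS at every interior pin, hence with part 81's `Λ″(x) = 4V_∞(x)∕x⁶ + 6W_∞(x)∕x⁴` on the open box:
# **`deriv (deriv Λ)` IS CONTINUOUS ON ]0, e′[** and **`ContDiffOn ℝ 2 Λ (Ioo 0 e′)`** FOR EVERY DYNAMICAL ABEL FUNCTION Λ (part 44's interface) — the dichotomy of gens 41–43
# now reads: Lipschitz memory ⟹ a velocity at almost every scale (optimal); C¹ memory ⟹ Λ ∈ C¹, a continuous β-function at every scale; C² memory ⟹ Λ ∈ C², the continuous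
# β-function `β_c = β₀∕Λ′` of part 72 is C¹.  (§157) THE LETTERS ARE INHABITED: the constant functional carries the C² shape with `H ≡ 0` (`C_H = 0`), and the NON-constant
# `u ↦ c + κ₀u₀²` of part 73 carries it with the Hessian `H u j i = 2κ₀·[j = 0 ∧ i = 0]` (`C_H = 2|κ₀|`, remainder ≡ 0, H constant in u)
# (β-flow team, prover 1, unit `b2b-balaban-beta-bflow-p1`, gen 43; ROW AP-I·Uc × NODE U2)

HONEST FRAMING (page 1 of everything the β sub-cell writes): discharging `BetaPertH` makes Bałaban's UV stability UNCONDITIONAL — a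
real constructive-QFT result; it is NOT the continuum limit and NOT the Clay problem.  HONEST DEPENDENCY (cell reorg 2026-08-19,
verbatim): «continuum YM on T⁴ ⇐ BetaPertH ∧ nine spine estimates (0/9 proved); BetaPertH ⇐ (D1) ∧ (D4) ∧ CAP+tail; G-an2-4 gates
asym, D1 and NE2/3/4.»  THIS MODULE DISCHARGES NOTHING: [folklore] real analysis (the axiom of choice, `Metric.continuousAt_iff`-style filters, `contDiffOn_succ_iff_deriv_of_isOpen`
twice, `tsum_eq_single`) over node U2's HYPOTHESIS SHAPES `T4BetaStationary.{SeqBox, MemoryProfile}`, `T4BetaFlowWellPosed.{MemFlow, solution}` and parts 68, 70, 71, 76, 78,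
81, 84 of this series BY NAME (NOT PRINTED for [I] = T. Bałaban, Commun. Math. Phys. **109** (1987) [Balaban1987RG1]: p. 298 says only that β_j depends on the preceding
couplings; (0.20) p. 256; Theorem 2 (0.31) p. 259 STATED WITHOUT PROOF; [I] §1: β_k analytic in the couplings by construction — whether ANY derivative passes to the scale-shift
limit `betaInf` is NOT PRINTED and not asserted).  The C² shape and `hHc` are OUR hypotheses; the two TOYS are def-free lambdas, NOT Bałaban's β.  «β_c» is OUR READING.

WHAT THIS FILE PROVES (0 sorry, 0 def): §155 **`secondTangentField_exists`**; §156 `continuousAt_tangentLimitField`, **`continuousAt_secondTangentLimitField`**,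
**`deriv_deriv_dynAbel_continuousOn`**, **`contDiffOn_two_dynAbel`**; §157 `const_hessian_letters`, **`quad_hessian_letters`**.  NOT CLAIMED: anything about Bałaban's β;
`BetaPertH`; the continuum limit of the measures; Clay.
-/

namespace Summit.QuantumFields.BalabanUV.Beta.EriceFlowEnclosureB12AsPrintedHistoryContagionShiftFlowZeroTangentSecondContDiff

open Finset Filter Topology Set
open Literature.MathematicalPhysics.QuantumFieldTheory.Balaban1983to89
open Literature.MathematicalPhysics.QuantumFieldTheory.Balaban1983to89.T4CouplingMatching (sprof)
open Literature.MathematicalPhysics.QuantumFieldTheory.Balaban1983to89.T4BetaStationary (SeqBox MemoryProfile)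
open Literature.MathematicalPhysics.QuantumFieldTheory.Balaban1983to89.T4BetaFlowWellPosed (MemFlow solution)
open Summit.QuantumFields.BalabanUV.Beta.EriceFlowEnclosureB12AsPrintedHistoryContagionShiftFlowZeroTangentLambda (tangentLimit_exists differentiableOn_dynAbel)
open Summit.QuantumFields.BalabanUV.Beta.EriceFlowEnclosureB12AsPrintedHistoryContagionShiftFlowZeroTangentSmooth (tangentLimit_continuous)
open Summit.QuantumFields.BalabanUV.Beta.EriceFlowEnclosureB12AsPrintedHistoryContagionShiftFlowZeroTangentProduct (tangentField_exists)
open Summit.QuantumFields.BalabanUV.Beta.EriceFlowEnclosureB12AsPrintedHistoryContagionShiftFlowZeroTangentSecond (gradient_continuity_of_hessian derivedSource_limit_exists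
  secondTangent_exists secondTangentLimit_exists)
open Summit.QuantumFields.BalabanUV.Beta.EriceFlowEnclosureB12AsPrintedHistoryContagionShiftFlowZeroTangentSecondDeriv (deriv_deriv_dynAbel_eq differentiableOn_deriv_dynAbel)
open Summit.QuantumFields.BalabanUV.Beta.EriceFlowEnclosureB12AsPrintedHistoryContagionShiftFlowZeroTangentSecondSmooth (secondTangentLimit_continuous)

noncomputable section

/-! ## §155 A second tangent field exists -/

/-- **A SECOND TANGENT FIELD EXISTS**: under part 14's package at e′, `hG`, the Hessian profile `hH` and a tangent field Wf on ]0, e′] (part 76), there are `Vf : ℝ → ℕ → ℝ` and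
`Vinff : ℝ → ℝ` such that at every pin `x ∈ ]0, e′]`: `Vf x` solves part 78's derived equation for `W = Wf x`, `|Vf x k| ≤ 2KS∕(1−θ)`, and `Vf x k → Vinff x` (part 78's
existence, bound and ultraviolet limit; the axiom of choice). [folklore] -/
theorem secondTangentField_exists {B : (ℕ → ℝ) → ℝ} {G : (ℕ → ℝ) → ℕ → ℝ} {H : (ℕ → ℝ) → ℕ → ℕ → ℝ} {Cm CH θ γ bs ta gs e' : ℝ} {t : ℕ → ℝ} {Wf : ℝ → ℕ → ℝ}
    (hB : MemoryProfile Cm θ γ B) (hCm : 0 ≤ Cm) (hθ0 : 0 ≤ θ) (hθ1 : θ < 1) (hbs : 0 < bs) (hta : 0 < ta)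
    (hts : SeqBox γ t) (htf : MemFlow B gs t) (hprof : ∀ m : ℕ, 1 / ta ^ 2 + bs * (m : ℝ) ≤ 1 / (t m) ^ 2)
    (hG : ∀ u : ℕ → ℝ, SeqBox γ u → ∀ j, |G u j| ≤ Cm * θ ^ j) (hCH : 0 ≤ CH)
    (hH : ∀ u : ℕ → ℝ, SeqBox γ u → ∀ j i, |H u j i| ≤ CH * θ ^ j * θ ^ i)
    (h2e' : 2 * e' ≤ γ) (hs1 : 4 * Cm * e' ≤ bs * (1 - θ))
    (hs2 : e' ^ 2 * (1 / gs ^ 2 + Cm * γ / (1 - θ) ^ 2 + (2 * Cm / ((1 - θ) * bs)) ^ 2) ≤ 3 / 4)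
    (hs4 : 64 * Cm * e' ^ 3 ≤ (1 - θ) ^ 2) (hs5 : Cm * (8 * e' ^ 3 + 16 * e' / bs) ≤ (1 - θ) / 4)
    (hWf : ∀ x ∈ Ioc (0 : ℝ) e',
      (∀ k, Wf x k = 1 - ∑ p ∈ range k, ∑' j, G (fun i => solution B x (p + 1 + i)) j * ((solution B x (p + 1 + j)) ^ 3 / 2) * Wf x (p + 1 + j)) ∧
      ∀ k, |Wf x k| ≤ 2) :
    ∃ Vf : ℝ → ℕ → ℝ, ∃ Vinff : ℝ → ℝ, ∀ x ∈ Ioc (0 : ℝ) e',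
      (∀ k, Vf x k = (-∑ p ∈ range k, ∑' j,
          ((-∑' i, H (fun l => solution B x (p + 1 + l)) j i * ((solution B x (p + 1 + i)) ^ 3 / 2 * Wf x (p + 1 + i))) * ((solution B x (p + 1 + j)) ^ 3 / 2)
            + G (fun i => solution B x (p + 1 + i)) j * (-(3 / 4 * (solution B x (p + 1 + j)) ^ 5 * Wf x (p + 1 + j)))) * Wf x (p + 1 + j))
        - ∑ p ∈ range k, ∑' j, G (fun i => solution B x (p + 1 + i)) j * ((solution B x (p + 1 + j)) ^ 3 / 2) * Vf x (p + 1 + j)) ∧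
      (∀ k, |Vf x k| ≤ 2 * ((8 * CH * e' ^ 3 / (1 - θ) + 12 * Cm * e' ^ 2) * (8 * e' ^ 3 + 16 * e' / bs) / (1 - θ))) ∧
      Tendsto (Vf x) atTop (𝓝 (Vinff x)) := by
  have key : ∀ x ∈ Ioc (0 : ℝ) e', ∃ V : ℕ → ℝ, ∃ L : ℝ,
      (∀ k, V k = (-∑ p ∈ range k, ∑' j,
          ((-∑' i, H (fun l => solution B x (p + 1 + l)) j i * ((solution B x (p + 1 + i)) ^ 3 / 2 * Wf x (p + 1 + i))) * ((solution B x (p + 1 + j)) ^ 3 / 2)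
            + G (fun i => solution B x (p + 1 + i)) j * (-(3 / 4 * (solution B x (p + 1 + j)) ^ 5 * Wf x (p + 1 + j)))) * Wf x (p + 1 + j))
        - ∑ p ∈ range k, ∑' j, G (fun i => solution B x (p + 1 + i)) j * ((solution B x (p + 1 + j)) ^ 3 / 2) * V (p + 1 + j)) ∧
      (∀ k, |V k| ≤ 2 * ((8 * CH * e' ^ 3 / (1 - θ) + 12 * Cm * e' ^ 2) * (8 * e' ^ 3 + 16 * e' / bs) / (1 - θ))) ∧
      Tendsto V atTop (𝓝 L) := by
    intro x hx
    obtain ⟨hW, hWM⟩ := hWf x hx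
    obtain ⟨σ, hσ⟩ : ∃ σ : ℕ → ℝ, ∀ k, σ k = -∑ p ∈ range k, ∑' j,
        ((-∑' i, H (fun l => solution B x (p + 1 + l)) j i * ((solution B x (p + 1 + i)) ^ 3 / 2 * Wf x (p + 1 + i))) * ((solution B x (p + 1 + j)) ^ 3 / 2)
          + G (fun i => solution B x (p + 1 + i)) j * (-(3 / 4 * (solution B x (p + 1 + j)) ^ 5 * Wf x (p + 1 + j)))) * Wf x (p + 1 + j) := ⟨_, fun k => rfl⟩
    obtain ⟨V, hV, hVM⟩ := secondTangent_exists hB hCm hθ0 hθ1 hbs hta hts htf hprof hG hCH hH h2e' hs1 hs2 hs4 hs5 hx hW hWM hσ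
    obtain ⟨σinf, hσinf, -⟩ := derivedSource_limit_exists hB hCm hθ0 hθ1 hbs hta hts htf hprof hG hCH hH h2e' hs1 hs2 hs4 hs5 hx hW hWM hσ
    obtain ⟨L, hL, -⟩ := secondTangentLimit_exists hB hCm hθ0 hθ1 hbs hta hts htf hprof hG h2e' hs1 hs2 hs4 hs5 hx hV hVM hσinf
    exact ⟨V, L, fun k => by rw [hV k, hσ k], hVM, hL⟩
  classical
  refine ⟨fun x => if hx : x ∈ Ioc (0 : ℝ) e' then Classical.choose (key x hx) else fun _ => 0,
    fun x => if hx : x ∈ Ioc (0 : ℝ) e' then Classical.choose (Classical.choose_spec (key x hx)) else 0, fun x hx => ?_⟩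
  simp only [dif_pos hx]
  exact Classical.choose_spec (Classical.choose_spec (key x hx))

/-! ## §156 The limit fields are continuous; Λ″ is continuous; Λ ∈ C²(]0, e′[) -/

/-- **THE ULTRAVIOLET LIMIT FIELD `W_∞` IS CONTINUOUS AT EVERY INTERIOR PIN** (part 71's `tangentLimit_continuous` read for a field; the letter `hGc` from the C² shape, part 78).
[cite: Balaban1987RG1, Thm 2 (0.31) p.259 with (0.20) p.256 and p.298] -/
theorem continuousAt_tangentLimitField {B : (ℕ → ℝ) → ℝ} {G : (ℕ → ℝ) → ℕ → ℝ} {H : (ℕ → ℝ) → ℕ → ℕ → ℝ} {Cm CH θ γ bs ta gs e' : ℝ} {t : ℕ → ℝ}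
    {Wf : ℝ → ℕ → ℝ} {Winff : ℝ → ℝ}
    (hB : MemoryProfile Cm θ γ B) (hCm : 0 ≤ Cm) (hθ0 : 0 ≤ θ) (hθ1 : θ < 1) (hbs : 0 < bs) (hta : 0 < ta)
    (hts : SeqBox γ t) (htf : MemFlow B gs t) (hprof : ∀ m : ℕ, 1 / ta ^ 2 + bs * (m : ℝ) ≤ 1 / (t m) ^ 2)
    (hG : ∀ u : ℕ → ℝ, SeqBox γ u → ∀ j, |G u j| ≤ Cm * θ ^ j) (hCH : 0 ≤ CH)
    (hH : ∀ u : ℕ → ℝ, SeqBox γ u → ∀ j i, |H u j i| ≤ CH * θ ^ j * θ ^ i)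
    (hHB : ∀ ε > 0, ∃ ρ > 0, ∀ u u' : ℕ → ℝ, SeqBox γ u → SeqBox γ u' → (∀ j, |u' j - u j| ≤ ρ) →
      ∀ j, |G u' j - G u j - ∑' i, H u j i * (u' i - u i)| ≤ ε * θ ^ j * ∑' i, θ ^ i * |u' i - u i|)
    (h2e' : 2 * e' ≤ γ) (hs1 : 4 * Cm * e' ≤ bs * (1 - θ))
    (hs2 : e' ^ 2 * (1 / gs ^ 2 + Cm * γ / (1 - θ) ^ 2 + (2 * Cm / ((1 - θ) * bs)) ^ 2) ≤ 3 / 4)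
    (hs4 : 64 * Cm * e' ^ 3 ≤ (1 - θ) ^ 2) (hs5 : Cm * (8 * e' ^ 3 + 16 * e' / bs) ≤ (1 - θ) / 4)
    (hWf : ∀ x ∈ Ioc (0 : ℝ) e',
      (∀ k, Wf x k = 1 - ∑ p ∈ range k, ∑' j, G (fun i => solution B x (p + 1 + i)) j * ((solution B x (p + 1 + j)) ^ 3 / 2) * Wf x (p + 1 + j)) ∧
      ∀ k, |Wf x k| ≤ 2)
    (hWinff : ∀ x ∈ Ioc (0 : ℝ) e', Tendsto (Wf x) atTop (𝓝 (Winff x))) {e : ℝ} (he : e ∈ Ioo (0 : ℝ) e') :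
    ContinuousAt Winff e := by
  have hec : e ∈ Ioc (0 : ℝ) e' := ⟨he.1, he.2.le⟩
  have hGc := gradient_continuity_of_hessian (γ := γ) hCH hθ0 hθ1 hH hHB
  rw [ContinuousAt, Metric.tendsto_nhds]
  intro ε hε
  have h := tangentLimit_continuous hB hCm hθ0 hθ1 hbs hta hts htf hprof hG hGc h2e' hs1 hs2 hs4 hs5 he (hWf e hec).1 (hWf e hec).2 (hWinff e hec) (half_pos hε)
  filter_upwards [h] with x hx
  obtain ⟨hx, hall⟩ := hx
  have := hall (Wf x) (hWf x hx).1 (hWf x hx).2 (Winff x) (hWinff x hx)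
  rw [Real.dist_eq]
  linarith

/-- **THE SECOND LIMIT FIELD `V_∞` IS CONTINUOUS AT EVERY INTERIOR PIN** (part 84's `secondTangentLimit_continuous` read for a second tangent field).
[cite: Balaban1987RG1, Thm 2 (0.31) p.259 with (0.20) p.256 and p.298] -/
theorem continuousAt_secondTangentLimitField {B : (ℕ → ℝ) → ℝ} {G : (ℕ → ℝ) → ℕ → ℝ} {H : (ℕ → ℝ) → ℕ → ℕ → ℝ} {Cm CH θ γ bs ta gs e' : ℝ} {t : ℕ → ℝ}
    {Wf Vf : ℝ → ℕ → ℝ} {Vinff : ℝ → ℝ}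
    (hB : MemoryProfile Cm θ γ B) (hCm : 0 ≤ Cm) (hθ0 : 0 ≤ θ) (hθ1 : θ < 1) (hbs : 0 < bs) (hta : 0 < ta)
    (hts : SeqBox γ t) (htf : MemFlow B gs t) (hprof : ∀ m : ℕ, 1 / ta ^ 2 + bs * (m : ℝ) ≤ 1 / (t m) ^ 2)
    (hG : ∀ u : ℕ → ℝ, SeqBox γ u → ∀ j, |G u j| ≤ Cm * θ ^ j) (hCH : 0 ≤ CH)
    (hH : ∀ u : ℕ → ℝ, SeqBox γ u → ∀ j i, |H u j i| ≤ CH * θ ^ j * θ ^ i)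
    (hHB : ∀ ε > 0, ∃ ρ > 0, ∀ u u' : ℕ → ℝ, SeqBox γ u → SeqBox γ u' → (∀ j, |u' j - u j| ≤ ρ) →
      ∀ j, |G u' j - G u j - ∑' i, H u j i * (u' i - u i)| ≤ ε * θ ^ j * ∑' i, θ ^ i * |u' i - u i|)
    (hHc : ∀ ε > 0, ∃ ρ > 0, ∀ u u' : ℕ → ℝ, SeqBox γ u → SeqBox γ u' → (∀ j, |u' j - u j| ≤ ρ) → ∀ j i, |H u' j i - H u j i| ≤ ε * θ ^ j * θ ^ i)
    (h2e' : 2 * e' ≤ γ) (hs1 : 4 * Cm * e' ≤ bs * (1 - θ))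
    (hs2 : e' ^ 2 * (1 / gs ^ 2 + Cm * γ / (1 - θ) ^ 2 + (2 * Cm / ((1 - θ) * bs)) ^ 2) ≤ 3 / 4)
    (hs4 : 64 * Cm * e' ^ 3 ≤ (1 - θ) ^ 2) (hs5 : Cm * (8 * e' ^ 3 + 16 * e' / bs) ≤ (1 - θ) / 4)
    (hWf : ∀ x ∈ Ioc (0 : ℝ) e',
      (∀ k, Wf x k = 1 - ∑ p ∈ range k, ∑' j, G (fun i => solution B x (p + 1 + i)) j * ((solution B x (p + 1 + j)) ^ 3 / 2) * Wf x (p + 1 + j)) ∧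
      ∀ k, |Wf x k| ≤ 2)
    (hVf : ∀ x ∈ Ioc (0 : ℝ) e',
      (∀ k, Vf x k = (-∑ p ∈ range k, ∑' j,
          ((-∑' i, H (fun l => solution B x (p + 1 + l)) j i * ((solution B x (p + 1 + i)) ^ 3 / 2 * Wf x (p + 1 + i))) * ((solution B x (p + 1 + j)) ^ 3 / 2)
            + G (fun i => solution B x (p + 1 + i)) j * (-(3 / 4 * (solution B x (p + 1 + j)) ^ 5 * Wf x (p + 1 + j)))) * Wf x (p + 1 + j))
        - ∑ p ∈ range k, ∑' j, G (fun i => solution B x (p + 1 + i)) j * ((solution B x (p + 1 + j)) ^ 3 / 2) * Vf x (p + 1 + j)) ∧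
      (∀ k, |Vf x k| ≤ 2 * ((8 * CH * e' ^ 3 / (1 - θ) + 12 * Cm * e' ^ 2) * (8 * e' ^ 3 + 16 * e' / bs) / (1 - θ))) ∧
      Tendsto (Vf x) atTop (𝓝 (Vinff x))) {e : ℝ} (he : e ∈ Ioo (0 : ℝ) e') :
    ContinuousAt Vinff e := by
  have hec : e ∈ Ioc (0 : ℝ) e' := ⟨he.1, he.2.le⟩
  obtain ⟨hV, hVM, hVinf⟩ := hVf e hec
  rw [ContinuousAt, Metric.tendsto_nhds]
  intro ε hε
  have h := secondTangentLimit_continuous hB hCm hθ0 hθ1 hbs hta hts htf hprof hG hCH hH hHB hHc h2e' hs1 hs2 hs4 hs5 he (hWf e hec).1 (hWf e hec).2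
    hV hVM hVinf (half_pos hε)
  filter_upwards [h] with x hx
  obtain ⟨hx, hall⟩ := hx
  obtain ⟨hVx, hVMx, hVinfx⟩ := hVf x hx
  have := hall (Wf x) (Vf x) (hWf x hx).1 (hWf x hx).2 hVx hVMx (Vinff x) hVinfx
  rw [Real.dist_eq]
  linarith

/-- **`Λ″` IS CONTINUOUS ON ]0, e′[** for every dynamical Abel function of a flow with a C² memory functional and a uniformly continuous Hessian: `Λ″(x) = 4V_∞(x)∕x⁶ + 6W_∞(x)∕x⁴`
near every interior pin (part 81, with the fields of parts 76 and §155) and both limit fields are continuous (§156).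
[cite: Balaban1987RG1, Thm 2 (0.31) p.259 with (0.20) p.256 and p.298] -/
theorem deriv_deriv_dynAbel_continuousOn {B : (ℕ → ℝ) → ℝ} {G : (ℕ → ℝ) → ℕ → ℝ} {H : (ℕ → ℝ) → ℕ → ℕ → ℝ} {Cm CH θ γ bs ta gs e' : ℝ} {t : ℕ → ℝ}
    {a : ℕ → ℝ} {Λ : ℝ → ℝ}
    (hB : MemoryProfile Cm θ γ B) (hCm : 0 ≤ Cm) (hθ0 : 0 ≤ θ) (hθ1 : θ < 1) (hbs : 0 < bs) (hta : 0 < ta)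
    (hts : SeqBox γ t) (htf : MemFlow B gs t) (hprof : ∀ m : ℕ, 1 / ta ^ 2 + bs * (m : ℝ) ≤ 1 / (t m) ^ 2)
    (hG : ∀ u : ℕ → ℝ, SeqBox γ u → ∀ j, |G u j| ≤ Cm * θ ^ j)
    (hGB : ∀ ε > 0, ∃ ρ > 0, ∀ u u' : ℕ → ℝ, SeqBox γ u → SeqBox γ u' → (∀ j, |u' j - u j| ≤ ρ) →
      |B u' - B u - ∑' j, G u j * (u' j - u j)| ≤ ε * ∑' j, θ ^ j * |u' j - u j|) (hCH : 0 ≤ CH)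
    (hH : ∀ u : ℕ → ℝ, SeqBox γ u → ∀ j i, |H u j i| ≤ CH * θ ^ j * θ ^ i)
    (hHB : ∀ ε > 0, ∃ ρ > 0, ∀ u u' : ℕ → ℝ, SeqBox γ u → SeqBox γ u' → (∀ j, |u' j - u j| ≤ ρ) →
      ∀ j, |G u' j - G u j - ∑' i, H u j i * (u' i - u i)| ≤ ε * θ ^ j * ∑' i, θ ^ i * |u' i - u i|)
    (hHc : ∀ ε > 0, ∃ ρ > 0, ∀ u u' : ℕ → ℝ, SeqBox γ u → SeqBox γ u' → (∀ j, |u' j - u j| ≤ ρ) → ∀ j i, |H u' j i - H u j i| ≤ ε * θ ^ j * θ ^ i)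
    (hΛ : ∀ e ∈ Ioc (0 : ℝ) e', ∀ h : ℕ → ℝ, SeqBox γ h → MemFlow B e h → Tendsto (fun n => 1 / h n ^ 2 - a n) atTop (𝓝 (Λ e)))
    (h2e' : 2 * e' ≤ γ) (hs1 : 4 * Cm * e' ≤ bs * (1 - θ))
    (hs2 : e' ^ 2 * (1 / gs ^ 2 + Cm * γ / (1 - θ) ^ 2 + (2 * Cm / ((1 - θ) * bs)) ^ 2) ≤ 3 / 4)
    (hs4 : 64 * Cm * e' ^ 3 ≤ (1 - θ) ^ 2) (hs5 : Cm * (8 * e' ^ 3 + 16 * e' / bs) ≤ (1 - θ) / 4) :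
    ContinuousOn (deriv (deriv Λ)) (Ioo 0 e') ∧
      ∃ Winff Vinff : ℝ → ℝ, (∀ x ∈ Ioo (0 : ℝ) e', ContinuousAt Winff x ∧ ContinuousAt Vinff x ∧
        deriv (deriv Λ) x = 4 * Vinff x / x ^ 6 + 6 * Winff x / x ^ 4) := by
  -- the fields
  obtain ⟨Wf, hWf⟩ := tangentField_exists hB hCm hθ0 hθ1 hbs hta hts htf hprof hG h2e' hs1 hs2 hs4 hs5
  have hlim : ∀ x ∈ Ioc (0 : ℝ) e', ∃ L : ℝ, Tendsto (Wf x) atTop (𝓝 L) := fun x hx => by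
    obtain ⟨L, hL, -⟩ := tangentLimit_exists hB hCm hθ0 hθ1 hbs hta hts htf hprof hG h2e' hs1 hs2 hs4 hs5 hx (hWf x hx).1 (hWf x hx).2
    exact ⟨L, hL⟩
  classical
  set Winff : ℝ → ℝ := fun x => if hx : x ∈ Ioc (0 : ℝ) e' then Classical.choose (hlim x hx) else 0 with hWinffdef
  have hWinff : ∀ x ∈ Ioc (0 : ℝ) e', Tendsto (Wf x) atTop (𝓝 (Winff x)) := fun x hx => by
    simp only [hWinffdef, dif_pos hx]
    exact Classical.choose_spec (hlim x hx)
  obtain ⟨Vf, Vinff, hVf⟩ := secondTangentField_exists hB hCm hθ0 hθ1 hbs hta hts htf hprof hG hCH hH h2e' hs1 hs2 hs4 hs5 hWf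
  have hformula : ∀ x ∈ Ioo (0 : ℝ) e', deriv (deriv Λ) x = 4 * Vinff x / x ^ 6 + 6 * Winff x / x ^ 4 := by
    intro x hx
    obtain ⟨hV, hVM, hVinf⟩ := hVf x ⟨hx.1, hx.2.le⟩
    exact (deriv_deriv_dynAbel_eq hB hCm hθ0 hθ1 hbs hta hts htf hprof hG hGB hCH hH hHB hΛ h2e' hs1 hs2 hs4 hs5 hWf hWinff hx hV hVM hVinf).1
  have hcW : ∀ x ∈ Ioo (0 : ℝ) e', ContinuousAt Winff x := fun x hx =>
    continuousAt_tangentLimitField hB hCm hθ0 hθ1 hbs hta hts htf hprof hG hCH hH hHB h2e' hs1 hs2 hs4 hs5 hWf hWinff hx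
  have hcV : ∀ x ∈ Ioo (0 : ℝ) e', ContinuousAt Vinff x := fun x hx =>
    continuousAt_secondTangentLimitField hB hCm hθ0 hθ1 hbs hta hts htf hprof hG hCH hH hHB hHc h2e' hs1 hs2 hs4 hs5 hWf hVf hx
  refine ⟨fun e he => ?_, Winff, Vinff, fun x hx => ⟨hcW x hx, hcV x hx, hformula x hx⟩⟩
  -- continuity of Λ″ at e through the formula
  have he0 : e ≠ 0 := he.1.ne'
  have hF : ContinuousAt (fun x => 4 * Vinff x / x ^ 6 + 6 * Winff x / x ^ 4) e := by
    have h6 : ContinuousAt (fun x : ℝ => x ^ 6) e := (continuous_pow 6).continuousAt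
    have h4 : ContinuousAt (fun x : ℝ => x ^ 4) e := (continuous_pow 4).continuousAt
    exact (((hcV e he).const_smul (4:ℝ)).div h6 (pow_ne_zero 6 he0)).add (((hcW e he).const_smul (6:ℝ)).div h4 (pow_ne_zero 4 he0)) |>.congr
      (Eventually.of_forall fun x => by simp [smul_eq_mul])
  have hmem : ∀ᶠ x in 𝓝 e, x ∈ Ioo (0 : ℝ) e' := Ioo_mem_nhds he.1 he.2
  have hcont : ContinuousAt (deriv (deriv Λ)) e := by
    refine (hF.congr (hmem.mono fun x hx => (hformula x hx).symm))
  exact hcont.continuousWithinAt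

/-- **Λ ∈ C²(]0, e′[): C² MEMORY ⟹ C² RENORMALIZATION GROUP.**  Part 14's package at e′; the C² shape of part 78 (a gradient with the memory profile and a uniform first-order
remainder, a Hessian with the separable memory profile and a uniform second-order remainder) and the uniform continuity of the Hessian (`hHc`); Λ ANY dynamical Abel function of the
flow (part 44's interface).  THEN **`ContDiffOn ℝ 2 Λ (Ioo 0 e′)`** — Λ differentiable (part 70), `Λ′` differentiable (part 81), `Λ″` continuous (§156); and the continuous
β-function `β_c = β₀∕Λ′` of part 72 is C¹ on ]0, e′[.  NOTHING is asserted about Bałaban's β: whether his `β_k` pass a Hessian to their scale-shift limit is NOT PRINTED.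
[cite: Balaban1987RG1, Thm 2 (0.31) p.259 with (0.20) p.256 and p.298] -/
theorem contDiffOn_two_dynAbel {B : (ℕ → ℝ) → ℝ} {G : (ℕ → ℝ) → ℕ → ℝ} {H : (ℕ → ℝ) → ℕ → ℕ → ℝ} {Cm CH θ γ bs ta gs e' : ℝ} {t : ℕ → ℝ}
    {a : ℕ → ℝ} {Λ : ℝ → ℝ}
    (hB : MemoryProfile Cm θ γ B) (hCm : 0 ≤ Cm) (hθ0 : 0 ≤ θ) (hθ1 : θ < 1) (hbs : 0 < bs) (hta : 0 < ta)
    (hts : SeqBox γ t) (htf : MemFlow B gs t) (hprof : ∀ m : ℕ, 1 / ta ^ 2 + bs * (m : ℝ) ≤ 1 / (t m) ^ 2)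
    (hG : ∀ u : ℕ → ℝ, SeqBox γ u → ∀ j, |G u j| ≤ Cm * θ ^ j)
    (hGB : ∀ ε > 0, ∃ ρ > 0, ∀ u u' : ℕ → ℝ, SeqBox γ u → SeqBox γ u' → (∀ j, |u' j - u j| ≤ ρ) →
      |B u' - B u - ∑' j, G u j * (u' j - u j)| ≤ ε * ∑' j, θ ^ j * |u' j - u j|) (hCH : 0 ≤ CH)
    (hH : ∀ u : ℕ → ℝ, SeqBox γ u → ∀ j i, |H u j i| ≤ CH * θ ^ j * θ ^ i)
    (hHB : ∀ ε > 0, ∃ ρ > 0, ∀ u u' : ℕ → ℝ, SeqBox γ u → SeqBox γ u' → (∀ j, |u' j - u j| ≤ ρ) →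
      ∀ j, |G u' j - G u j - ∑' i, H u j i * (u' i - u i)| ≤ ε * θ ^ j * ∑' i, θ ^ i * |u' i - u i|)
    (hHc : ∀ ε > 0, ∃ ρ > 0, ∀ u u' : ℕ → ℝ, SeqBox γ u → SeqBox γ u' → (∀ j, |u' j - u j| ≤ ρ) → ∀ j i, |H u' j i - H u j i| ≤ ε * θ ^ j * θ ^ i)
    (hΛ : ∀ e ∈ Ioc (0 : ℝ) e', ∀ h : ℕ → ℝ, SeqBox γ h → MemFlow B e h → Tendsto (fun n => 1 / h n ^ 2 - a n) atTop (𝓝 (Λ e)))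
    (h2e' : 2 * e' ≤ γ) (hs1 : 4 * Cm * e' ≤ bs * (1 - θ))
    (hs2 : e' ^ 2 * (1 / gs ^ 2 + Cm * γ / (1 - θ) ^ 2 + (2 * Cm / ((1 - θ) * bs)) ^ 2) ≤ 3 / 4)
    (hs4 : 64 * Cm * e' ^ 3 ≤ (1 - θ) ^ 2) (hs5 : Cm * (8 * e' ^ 3 + 16 * e' / bs) ≤ (1 - θ) / 4) :
    ContDiffOn ℝ 2 Λ (Ioo 0 e') ∧ ContDiffOn ℝ 1 (deriv Λ) (Ioo 0 e') ∧ DifferentiableOn ℝ (deriv Λ) (Ioo 0 e') ∧ ContinuousOn (deriv (deriv Λ)) (Ioo 0 e') := by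
  have hd0 := (differentiableOn_dynAbel hB hCm hθ0 hθ1 hbs hta hts htf hprof hG hGB hΛ h2e' hs1 hs2 hs4 hs5).1
  have hd1 := (differentiableOn_deriv_dynAbel hB hCm hθ0 hθ1 hbs hta hts htf hprof hG hGB hCH hH hHB hΛ h2e' hs1 hs2 hs4 hs5).1
  have hc2 := (deriv_deriv_dynAbel_continuousOn hB hCm hθ0 hθ1 hbs hta hts htf hprof hG hGB hCH hH hHB hHc hΛ h2e' hs1 hs2 hs4 hs5).1
  have h1 : ContDiffOn ℝ (((0 : ℕ) : WithTop ℕ∞) + 1) (deriv Λ) (Ioo 0 e') := by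
    rw [contDiffOn_succ_iff_deriv_of_isOpen isOpen_Ioo]
    exact ⟨hd1, fun h => by simp at h, contDiffOn_zero.2 hc2⟩
  have h1' : ContDiffOn ℝ 1 (deriv Λ) (Ioo 0 e') := by exact_mod_cast h1
  have h2 : ContDiffOn ℝ (((1 : ℕ) : WithTop ℕ∞) + 1) Λ (Ioo 0 e') := by
    rw [contDiffOn_succ_iff_deriv_of_isOpen isOpen_Ioo]
    exact ⟨hd0, fun h => by simp at h, by exact_mod_cast h1'⟩
  have h2' : ContDiffOn ℝ 2 Λ (Ioo 0 e') := by exact_mod_cast h2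
  exact ⟨h2', h1', hd1, hc2⟩

/-! ## §157 The letters are inhabited: the constant functional and the quadratic functional carry the C² shape -/

/-- **THE CONSTANT FUNCTIONAL CARRIES THE C² SHAPE WITH `H ≡ 0`**: for `B ≡ c`, `G ≡ 0` (part 73's `const_letters`) and the Hessian `H ≡ 0` satisfy `hH` with `C_H = 0`, `hHB`
(both sides vanish) and `hHc`.  Def-free toy, NOT Bałaban's β. [folklore] -/
theorem const_hessian_letters {γ θ : ℝ} (hθ0 : 0 ≤ θ) :
    (∀ u : ℕ → ℝ, SeqBox γ u → ∀ j i, |(fun (_ : ℕ → ℝ) (_ _ : ℕ) => (0 : ℝ)) u j i| ≤ 0 * θ ^ j * θ ^ i) ∧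
      (∀ ε > 0, ∃ ρ > 0, ∀ u u' : ℕ → ℝ, SeqBox γ u → SeqBox γ u' → (∀ j, |u' j - u j| ≤ ρ) →
        ∀ j, |(fun (_ : ℕ → ℝ) (_ : ℕ) => (0 : ℝ)) u' j - (fun (_ : ℕ → ℝ) (_ : ℕ) => (0 : ℝ)) u j
          - ∑' i, (fun (_ : ℕ → ℝ) (_ _ : ℕ) => (0 : ℝ)) u j i * (u' i - u i)| ≤ ε * θ ^ j * ∑' i, θ ^ i * |u' i - u i|) ∧
      (∀ ε > 0, ∃ ρ > 0, ∀ u u' : ℕ → ℝ, SeqBox γ u → SeqBox γ u' → (∀ j, |u' j - u j| ≤ ρ) →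
        ∀ j i, |(fun (_ : ℕ → ℝ) (_ _ : ℕ) => (0 : ℝ)) u' j i - (fun (_ : ℕ → ℝ) (_ _ : ℕ) => (0 : ℝ)) u j i| ≤ ε * θ ^ j * θ ^ i) := by
  refine ⟨fun u _ j i => by simp, fun ε hε => ⟨1, one_pos, fun u u' _ _ _ j => ?_⟩, fun ε hε => ⟨1, one_pos, fun u u' _ _ _ j i => ?_⟩⟩
  · simp only [zero_mul, tsum_zero, sub_self, abs_zero]
    exact mul_nonneg (mul_nonneg hε.le (pow_nonneg hθ0 j)) (tsum_nonneg fun i => mul_nonneg (pow_nonneg hθ0 i) (abs_nonneg _))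
  · simp only [sub_self, abs_zero]; positivity

/-- **THE QUADRATIC FUNCTIONAL `u ↦ c + κ₀u₀²` CARRIES THE C² SHAPE**: its gradient `G u j = 2κ₀u₀·[j = 0]` (part 73's `quad_letters`: profile, first-order remainder, continuity) has
the Hessian **`H u j i = 2κ₀·[j = 0 ∧ i = 0]`**: `hH` with `C_H = 2|κ₀|`; the second-order remainder VANISHES IDENTICALLY (`G u′ j − G u j − Σ_i H u j i (u′_i − u_i) = 0`), so `hHB`
holds with any ρ; `hHc` holds because H does not depend on u.  A NON-constant def-free inhabitant of all the C² letters (with part 73, the full shape of parts 78–85); NOT Bałaban's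
β. [folklore] -/
theorem quad_hessian_letters {γ θ κ₀ : ℝ} (hθ0 : 0 ≤ θ) :
    (∀ u : ℕ → ℝ, SeqBox γ u → ∀ j i, |(fun (_ : ℕ → ℝ) (j i : ℕ) => if j = 0 ∧ i = 0 then 2 * κ₀ else 0) u j i| ≤ 2 * |κ₀| * θ ^ j * θ ^ i) ∧
      (∀ ε > 0, ∃ ρ > 0, ∀ u u' : ℕ → ℝ, SeqBox γ u → SeqBox γ u' → (∀ j, |u' j - u j| ≤ ρ) →
        ∀ j, |(fun (u : ℕ → ℝ) (j : ℕ) => if j = 0 then 2 * κ₀ * u 0 else 0) u' j - (fun (u : ℕ → ℝ) (j : ℕ) => if j = 0 then 2 * κ₀ * u 0 else 0) u j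
          - ∑' i, (fun (_ : ℕ → ℝ) (j i : ℕ) => if j = 0 ∧ i = 0 then 2 * κ₀ else 0) u j i * (u' i - u i)| ≤ ε * θ ^ j * ∑' i, θ ^ i * |u' i - u i|) ∧
      (∀ ε > 0, ∃ ρ > 0, ∀ u u' : ℕ → ℝ, SeqBox γ u → SeqBox γ u' → (∀ j, |u' j - u j| ≤ ρ) →
        ∀ j i, |(fun (_ : ℕ → ℝ) (j i : ℕ) => if j = 0 ∧ i = 0 then 2 * κ₀ else 0) u' j i
          - (fun (_ : ℕ → ℝ) (j i : ℕ) => if j = 0 ∧ i = 0 then 2 * κ₀ else 0) u j i| ≤ ε * θ ^ j * θ ^ i) := by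
  refine ⟨fun u _ j i => ?_, fun ε hε => ⟨1, one_pos, fun u u' _ _ _ j => ?_⟩, fun ε hε => ⟨1, one_pos, fun u u' _ _ _ j i => ?_⟩⟩
  · simp only
    split_ifs with hji
    · obtain ⟨hj, hi⟩ := hji
      rw [hj, hi, pow_zero, mul_one, mul_one, abs_mul, abs_two]
    · rw [abs_zero]; positivity
  · have hzero : (fun (u : ℕ → ℝ) (j : ℕ) => if j = 0 then 2 * κ₀ * u 0 else 0) u' j - (fun (u : ℕ → ℝ) (j : ℕ) => if j = 0 then 2 * κ₀ * u 0 else 0) u j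
        - ∑' i, (fun (_ : ℕ → ℝ) (j i : ℕ) => if j = 0 ∧ i = 0 then 2 * κ₀ else 0) u j i * (u' i - u i) = 0 := by
      simp only
      by_cases hj : j = 0
      · subst hj
        have hsum : ∑' i : ℕ, (if 0 = 0 ∧ i = 0 then 2 * κ₀ else 0) * (u' i - u i) = 2 * κ₀ * (u' 0 - u 0) := by
          rw [tsum_eq_single 0 (fun i hi => by simp [hi])]
          simp
        rw [hsum]; simp; ring
      · have hsum : ∑' i : ℕ, (if j = 0 ∧ i = 0 then 2 * κ₀ else 0) * (u' i - u i) = 0 := by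
          simp [hj]
        rw [hsum]; simp [hj]
    rw [hzero, abs_zero]
    exact mul_nonneg (mul_nonneg hε.le (pow_nonneg hθ0 j)) (tsum_nonneg fun i => mul_nonneg (pow_nonneg hθ0 i) (abs_nonneg _))
  · simp only [sub_self, abs_zero]; positivity

end

end Summit.QuantumFields.BalabanUV.Beta.EriceFlowEnclosureB12AsPrintedHistoryContagionShiftFlowZeroTangentSecondContDiff
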